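import Summits.QuantumFields.QCD.Theorems.ExtinctionBuildsQCD.Negative.TightPinsLine

/-!
# Stub `stub_massPinAbsLeOne` of line `weyl-window` (crux `SpectralDefectExtinction.ExtinctionBuildsQCD`,
# item stmt-QuantumFields-8968) — the flavour bare masses of a tight, mass-scaling regularisation are eventually in `[−1, 1]`

Part 1/4 of the composed stub `stub_fermiProjectorScreening` (the Aizenman–Graf step of line `weyl-window`, lead
seat c2, cycle 2).  The Aizenman–Graf representation is applied to `H_W(U, m_f(k)) = Γ₅ D_W(U, m_f(k), 1)` with the
spectral bound `‖H_W‖ ≤ |m_f(k) + 4| + 4`; this file supplies the `k`-UNIFORM version `|m_f(k)| ≤ 1` eventually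
(hence spectrum in `[−9, 9]`): TIGHT pins the flavour-blind line from above (`Tight.eventually_probe_mem`: for every
`M > M₀`, eventually `m_crit(k) − a_k M/Z_m(k) ∈ [−8, 0]`), the branch clause `−1 < m_crit(k)` pins it from below,
and `HasMassScaling` (`Z_m(k) ≍ c (log a_k⁻²)^{γ₀/(2β₀)}` with `γ₀/(2β₀) ≥ 0` for `N_f ≤ 16`) gives `a_k/Z_m(k) → 0`.
-/

noncomputable section

namespace Summit.QuantumFields.QCD.Cruxes.ExtinctionBuildsQCD.WeylWindow

open scoped BigOperators
open Filter
open Literature.MathematicalPhysics.QuantumLattice Literature.MathematicalPhysics.QuantumFieldTheory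
  Literature.Probability.LatticeModels
open Summit.QuantumFields.QCD.Theorems.ExtinctionBuildsQCD.Negative (Tight)

section MassPin

variable {Nf : ℕ}

/-- **Mass renormalisation does not run away downwards**: under `HasMassScaling` (and `N_f ≤ 16`),
`a_k / Z_m(k) → 0`; precisely, for every `ε > 0`, eventually `a_k ≤ ε Z_m(k)`. -/
theorem eventually_a_le_mul_Zm (hNf : Nf ≤ 16) (reg : QCDRegularisation Nf) (hMS : reg.HasMassScaling)
    {ε : ℝ} (hε : 0 < ε) : ∀ᶠ k in atTop, reg.a k ≤ ε * reg.Zm k := by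
  obtain ⟨c, hc, hZ⟩ := hMS
  -- eventually `log(1/a_k²) ≥ 1`, hence `log(1/a_k²)^p ≥ 1`
  have ha0 := reg.tendsto_a
  have hsmall : ∀ᶠ k in atTop, reg.a k < Real.exp (-1) :=
    ha0.eventually (eventually_lt_nhds (Real.exp_pos _))
  have hratio : ∀ᶠ k in atTop, c / 2 < reg.Zm k / Real.log (1 / reg.a k ^ 2) ^ massExponent Nf :=
    (tendsto_order.1 hZ).1 (c / 2) (by linarith)
  have hac : ∀ᶠ k in atTop, reg.a k < ε * (c / 2) :=
    ha0.eventually (eventually_lt_nhds (by positivity))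
  filter_upwards [hsmall, hratio, hac] with k hk hr hkc
  have hapos := reg.a_pos k
  have hlog : 1 ≤ Real.log (1 / reg.a k ^ 2) := by
    rw [Real.le_log_iff_exp_le (by positivity)]
    have h1 : reg.a k ^ 2 ≤ Real.exp (-1) ^ 2 := pow_le_pow_left₀ hapos.le hk.le 2
    have hE : Real.exp 1 * Real.exp (-1) = 1 := by rw [← Real.exp_add]; norm_num
    have hle1 : Real.exp (-1) ≤ 1 := Real.exp_le_one_iff.2 (by norm_num)
    rw [le_div_iff₀ (by positivity)]
    calc Real.exp 1 * reg.a k ^ 2 ≤ Real.exp 1 * Real.exp (-1) ^ 2 :=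
          mul_le_mul_of_nonneg_left h1 (Real.exp_pos 1).le
      _ = Real.exp (-1) := by rw [sq, ← mul_assoc, hE, one_mul]
      _ ≤ 1 := hle1
  -- `γ₀/(2β₀) ≥ 0` for `N_f ≤ 16` (asymptotic freedom; cf. the tree's `glue_massExponent_nonneg`)
  have hexp : 0 ≤ massExponent Nf := by
    have h16 : (Nf : ℝ) ≤ 16 := by exact_mod_cast hNf
    have hb : 0 < 11 - 2 * (Nf : ℝ) / 3 := by linarith
    have hπ : 0 < 16 * Real.pi ^ 2 := by positivity
    unfold massExponent gammaCoeff₀ betaCoeff₀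
    exact div_nonneg (div_nonneg (by norm_num) hπ.le) (mul_nonneg (by norm_num) (div_nonneg hb.le hπ.le))
  have hpow : 1 ≤ Real.log (1 / reg.a k ^ 2) ^ massExponent Nf := Real.one_le_rpow hlog hexp
  have hpowpos : 0 < Real.log (1 / reg.a k ^ 2) ^ massExponent Nf := by linarith
  have hZge : c / 2 ≤ reg.Zm k := by
    have := (lt_div_iff₀ hpowpos).1 hr
    nlinarith
  nlinarith

/-- **Stub `stub_massPinAbsLeOne` — the flavour bare masses are eventually in `[−1, 1]`.**  For `N_f ≤ 16`, a
mass-scaling regularisation whose line is eventually on the physical branch (`−1 < m_crit(k)`) and which is TIGHT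
above `M₀` at the mass tuple `m > M₀` has `|m_f(k)| = |m_crit(k) + a_k m_f/Z_m(k)| ≤ 1` for all flavours, eventually in
`k`: TIGHT pins the line from above (`m_crit(k) ≤ a_k(M₀+1)/Z_m(k)`, landed `Tight.eventually_probe_mem`), `Branch` from
below, and `a_k/Z_m(k) → 0` (`HasMassScaling`). -/
theorem stub_massPinAbsLeOne :
    ∀ (Nf : ℕ), Nf ≤ 16 → ∀ (reg : QCDRegularisation Nf) (M₀ : ℝ), 0 ≤ M₀ → reg.HasMassScaling →
      (∀ᶠ k in atTop, -1 < reg.mcrit k) → ∀ m : Fin Nf → ℝ, (∀ f, M₀ < m f) →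
      Summit.QuantumFields.QCD.Theorems.ExtinctionBuildsQCD.Negative.Tight Nf reg M₀ m →
      ∀ᶠ k in atTop, ∀ f, |reg.mcrit k + reg.a k * m f / reg.Zm k| ≤ 1 := by
  intro Nf hNf reg M₀ hM₀ hMS hbr m hm hT
  have hpin := Tight.eventually_probe_mem reg M₀ m hT (M := M₀ + 1) (by linarith)
  set B : ℝ := M₀ + 1 + ∑ f, m f with hB
  have hmpos : ∀ f, 0 < m f := fun f => hM₀.trans_lt (hm f)
  have hBpos : 0 < B := by
    have : 0 ≤ ∑ f, m f := Finset.sum_nonneg fun f _ => (hmpos f).le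
    linarith
  have hsmall := eventually_a_le_mul_Zm hNf reg hMS (ε := 1 / B) (by positivity)
  filter_upwards [hpin, hbr, hsmall] with k hk hb ha f
  have hZ := reg.Zm_pos k
  have hapos := reg.a_pos k
  have hmf : m f ≤ ∑ g, m g :=
    Finset.single_le_sum (f := fun g => m g) (fun g _ => (hmpos g).le) (Finset.mem_univ f)
  have hup : reg.mcrit k ≤ reg.a k * (M₀ + 1) / reg.Zm k := by
    have := hk.2
    linarith
  have hfrac : reg.a k * (M₀ + 1) / reg.Zm k + reg.a k * m f / reg.Zm k ≤ 1 := by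
    rw [← add_div, ← mul_add, div_le_one hZ]
    calc reg.a k * (M₀ + 1 + m f) ≤ reg.a k * B := by
          refine mul_le_mul_of_nonneg_left ?_ hapos.le
          rw [hB]; linarith
      _ ≤ 1 / B * reg.Zm k * B := mul_le_mul_of_nonneg_right ha hBpos.le
      _ = reg.Zm k := by field_simp
  have hpos : 0 < reg.a k * m f / reg.Zm k := div_pos (mul_pos hapos (hmpos f)) hZ
  rw [abs_le]
  constructor <;> linarith

end MassPin

end Summit.QuantumFields.QCD.Cruxes.ExtinctionBuildsQCD.WeylWindow

end
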